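import Literature.AlgebraicGeometry.Resolution.RegularCentreRsopPart
import Mathlib.RingTheory.KrullDimension.NonZeroDivisors
import HarnessLib

/-!
# A regular sequence with regular final quotient is part of a regular system of parameters

Topic: `Literature/AlgebraicGeometry/Resolution`. A dimension-free form of Matsumura's
criterion for parts of regular systems of parameters (Matsumura, *Commutative Ring Theory*,
Thm. 14.2 and the Remark after it, tree: `IsRsopPart.of_isRegularLocalRing_quotient`: in a
Noetherian local ring `R`, elements `g₁, …, g_m ∈ 𝔪` with `R/(g)` regular and
`dim R/(g) + m ≤ dim R` form part of a regular system of parameters): the dimension inequality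
holds as soon as each `g_i` is a non-zero-divisor modulo `(g₁, …, g_{i-1})` (Krull:
`dim S/(x) + 1 ≤ dim S` for a non-zero-divisor `x`, Mathlib
`ringKrullDim_quotient_succ_le_of_nonZeroDivisor`). This is the form in which simple normal
crossings are verified in the FIBRES of a family (spreading out of resolutions,
`SpreadsShapedFromGenericPoint`, `CanonicalResolutionSpread.lean`): non-zero-divisors modulo
flat quotients survive base change (`tmul_one_mem_nonZeroDivisors_of_flat_quotient`,
`BlowupsRelativeCartier.lean`) while dimension counts do not transfer directly. PROVED:

* `ringKrullDim_quotient_span_image_add_le` — `dim R/(g₁, …, g_i) + i ≤ dim R` when each `g_j`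
  is a non-zero-divisor modulo the previous ones;
* `IsRsopPart.of_forall_mem_nonZeroDivisors` — **`g₁, …, g_m ∈ 𝔪` successively
  non-zero-divisors with `R/(g₁, …, g_m)` a regular local ring ⇒ `g` is part of a regular
  system of parameters** (and `R` is regular).
* `exists_isRsopPart_append_span_eq` — **a regular system of parameters adapted to a regular
  centre and to divisors** (the local algebra of "the centre `V(J)` has simple normal crossings
  with the divisors", BGMW Def. 3.1.3 (2), in the labelled rsop-part form of
  `hasSNCWith_of_isRsopPart_labels`, `StrictNormalCrossingsLabels.lean`): if `R/J` is regular,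
  `a₁, …, a_p ∈ J` is a part of a regular system of parameters of `R` (local equations of the
  divisors containing the centre) and `b₁, …, b_q ∈ 𝔪` become a part of a regular system of
  parameters of `R/J` (local equations of the divisors transversal to the centre), then there
  are `c₁, …, c_r ∈ J` such that `(a, c, b)` is a part of a regular system of parameters of
  `R` and `J = (a, c)`.

## Sources

* H. Matsumura, *Commutative Ring Theory* (1986), Thm. 14.2 and Remark; Thm. 17.4 (regular
  sequences and dimension). [Matsumura1987]
-/

noncomputable section

open IsLocalRing

namespace Literature.AlgebraicGeometry.Resolution

universe u

variable {R : Type u} [CommRing R]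

/-- `(g_j : j < i + 1) = (g_j : j < i) + (g_i)` for a family `g : Fin m → R`. [folklore] -/
theorem span_image_lt_succ {m : ℕ} (g : Fin m → R) (i : Fin m) :
    Ideal.span (g '' {j : Fin m | (j : ℕ) < (i : ℕ) + 1}) =
      Ideal.span (g '' {j : Fin m | (j : ℕ) < (i : ℕ)}) ⊔ Ideal.span {g i} := by
  have hset : {j : Fin m | (j : ℕ) < (i : ℕ) + 1} = {j : Fin m | (j : ℕ) < (i : ℕ)} ∪ {i} := by
    ext j
    simp only [Set.mem_setOf_eq, Set.mem_union, Set.mem_singleton_iff]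
    constructor
    · intro h
      rcases Nat.lt_succ_iff_lt_or_eq.mp h with h | h
      · exact Or.inl h
      · exact Or.inr (Fin.ext h)
    · rintro (h | rfl)
      · exact Nat.lt_succ_of_lt h
      · exact Nat.lt_succ_self _
  rw [hset, Set.image_union, Set.image_singleton, Ideal.span_union]

/-- **`dim R/(g₁, …, g_i) + i ≤ dim R`** if each `g_j` (`j < i`) is a non-zero-divisor modulo
`(g₁, …, g_{j-1})` (Krull's principal ideal theorem in the form
`dim S/(x) + 1 ≤ dim S` for a non-zero-divisor `x`, iterated). [cite: Matsumura1987, Thm. 17.4] -/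
theorem ringKrullDim_quotient_span_image_add_le {m : ℕ} (g : Fin m → R)
    (hnzd : ∀ i : Fin m, Ideal.Quotient.mk (Ideal.span (g '' {j : Fin m | (j : ℕ) < (i : ℕ)})) (g i) ∈
      nonZeroDivisors (R ⧸ Ideal.span (g '' {j : Fin m | (j : ℕ) < (i : ℕ)}))) :
    ∀ i : ℕ, i ≤ m →
      ringKrullDim (R ⧸ Ideal.span (g '' {j : Fin m | (j : ℕ) < i})) + i ≤ ringKrullDim R := by
  intro i
  induction i with
  | zero =>
    intro _
    have h0 : Ideal.span (g '' {j : Fin m | (j : ℕ) < 0}) = ⊥ := by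
      rw [Ideal.span_eq_bot]
      rintro _ ⟨j, hj, rfl⟩
      exact absurd hj (Nat.not_lt_zero _)
    rw [Nat.cast_zero, add_zero, h0]
    exact (ringKrullDim_eq_of_ringEquiv (RingEquiv.quotientBot R)).le
  | succ i ih =>
    intro hi
    have him : i < m := Nat.lt_of_succ_le hi
    set J : Ideal R := Ideal.span (g '' {j : Fin m | (j : ℕ) < i}) with hJ
    -- `dim R/(J + (g_i)) + 1 ≤ dim R/J`
    have h1 := ringKrullDim_quotient_succ_le_of_nonZeroDivisor (hnzd ⟨i, him⟩)
    have heq : Ideal.span {Ideal.Quotient.mk J (g ⟨i, him⟩)} =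
        (Ideal.span {g ⟨i, him⟩}).map (Ideal.Quotient.mk J) := by
      rw [Ideal.map_span, Set.image_singleton]
    have e : (R ⧸ J) ⧸ Ideal.span {Ideal.Quotient.mk J (g ⟨i, him⟩)} ≃+*
        R ⧸ Ideal.span (g '' {j : Fin m | (j : ℕ) < i + 1}) :=
      (Ideal.quotEquivOfEq heq).trans ((DoubleQuot.quotQuotEquivQuotSup J _).trans
        (Ideal.quotEquivOfEq (span_image_lt_succ g ⟨i, him⟩).symm))
    rw [ringKrullDim_eq_of_ringEquiv e] at h1
    -- combine with the induction hypothesis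
    have ih' := ih (Nat.le_of_succ_le hi)
    calc ringKrullDim (R ⧸ Ideal.span (g '' {j : Fin m | (j : ℕ) < i + 1})) + ((i + 1 : ℕ) : WithBot ℕ∞)
        = (ringKrullDim (R ⧸ Ideal.span (g '' {j : Fin m | (j : ℕ) < i + 1})) + 1) + (i : ℕ) := by
          rw [Nat.cast_succ, add_assoc, add_comm (1 : WithBot ℕ∞)]
      _ ≤ ringKrullDim (R ⧸ J) + (i : ℕ) := by gcongr
      _ ≤ ringKrullDim R := ih'

/-- **A regular sequence in `𝔪` with regular final quotient is part of a regular system of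
parameters** (Matsumura Thm. 14.2 with its Remark, dimension-free form): in a Noetherian
local ring `R`, if `g₁, …, g_m ∈ 𝔪`, each `g_i` is a non-zero-divisor of
`R/(g₁, …, g_{i-1})`, and `R/(g₁, …, g_m)` is a regular local ring, then `R` is regular and
`g` is part of a regular system of parameters (`IsRsopPart g`).
[cite: Matsumura1987, Thm. 14.2 (Remark) and Thm. 17.4] -/
theorem IsRsopPart.of_forall_mem_nonZeroDivisors [IsLocalRing R] [IsNoetherianRing R] {m : ℕ}
    {g : Fin m → R} (hgm : ∀ i, g i ∈ maximalIdeal R)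
    (hnzd : ∀ i : Fin m, Ideal.Quotient.mk (Ideal.span (g '' {j : Fin m | (j : ℕ) < (i : ℕ)})) (g i) ∈
      nonZeroDivisors (R ⧸ Ideal.span (g '' {j : Fin m | (j : ℕ) < (i : ℕ)})))
    [hq : IsRegularLocalRing (R ⧸ Ideal.span (Set.range g))] : IsRsopPart g := by
  refine IsRsopPart.of_isRegularLocalRing_quotient hgm ?_
  have hall : Ideal.span (g '' {j : Fin m | (j : ℕ) < m}) = Ideal.span (Set.range g) := by
    congr 1
    ext a
    constructor
    · rintro ⟨j, -, rfl⟩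
      exact ⟨j, rfl⟩
    · rintro ⟨j, rfl⟩
      exact ⟨j, j.2, rfl⟩
  have h := ringKrullDim_quotient_span_image_add_le g hnzd m le_rfl
  rwa [hall] at h

/-! ## A regular system of parameters adapted to a regular centre and to divisors -/

/-- **A regular system of parameters adapted to a regular centre and to divisors through a
point** (the local algebra behind "`V(J)` has simple normal crossings with `E`", BGMW
Def. 3.1.3 (2)): let `R` be a Noetherian local ring and `J` an ideal with `R/J` regular; let
`a : Fin p → J` be a part of a regular system of parameters of `R` (so `R` is regular) and
`b : Fin q → 𝔪` a family whose image in `R/J` is a part of a regular system of parameters of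
`R/J`. Then there is `c : Fin r → J` such that the concatenated family `(a, c, b)` is a part of
a regular system of parameters of `R` and `J = (a, c)`. Proof: in the regular local ring
`R̄ = R/(a)` the image `J̄` of `J` has regular quotient `R̄/J̄ = R/J`, so `J̄ = (c̄)` for a part
`c̄` of a regular system of parameters of `R̄` (Matsumura 14.2,
`exists_isRsopPart_span_range_eq`); lift `c̄` to `c ∈ J`; then `J = (a, c)`,
`R/(a, c, b) = (R/J)/(b̄)` is regular and the dimensions add up
(`IsRsopPart.ringKrullDim_quotient_add` three times), so `(a, c, b)` is a part of a regular
system of parameters (`IsRsopPart.of_isRegularLocalRing_quotient`).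
[cite: Matsumura1987, Thm. 14.2; BierstoneGrigorievMilmanWlodarczyk2011, Def. 3.1.3 (2)] -/
theorem exists_isRsopPart_append_span_eq [IsLocalRing R] [IsNoetherianRing R] {J : Ideal R}
    [hJ : IsRegularLocalRing (R ⧸ J)] {p q : ℕ} {a : Fin p → R} {b : Fin q → R}
    (ha : IsRsopPart a) (haJ : ∀ k, a k ∈ J) (hbm : ∀ k, b k ∈ maximalIdeal R)
    (hb : haveI : IsLocalRing (R ⧸ J) := inferInstance
      IsRsopPart (Ideal.Quotient.mk J ∘ b)) :
    ∃ (r : ℕ) (c : Fin r → R), (∀ k, c k ∈ J) ∧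
      IsRsopPart (Fin.append (Fin.append a c) b) ∧
      Ideal.span (Set.range (Fin.append a c)) = J := by
  classical
  -- the range of an appended family (`range_fin_append` of `AlterationsEnlargingZ.lean`,
  -- re-proved locally to keep the imports small)
  have range_fin_append' : ∀ {m n : ℕ} (u : Fin m → R) (v : Fin n → R),
      Set.range (Fin.append u v) = Set.range u ∪ Set.range v := by
    intro m n u v
    ext x
    constructor
    · rintro ⟨i, rfl⟩
      refine Fin.addCases (fun j => ?_) (fun j => ?_) i
      · exact Or.inl ⟨j, (Fin.append_left u v j).symm⟩
      · exact Or.inr ⟨j, (Fin.append_right u v j).symm⟩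
    · rintro (⟨j, rfl⟩ | ⟨j, rfl⟩)
      · exact ⟨Fin.castAdd n j, Fin.append_left u v j⟩
      · exact ⟨Fin.natAdd m j, Fin.append_right u v j⟩
  haveI : IsRegularLocalRing R := ha.isRegularLocalRing
  -- `J ⊆ 𝔪`
  have hJtop : J ≠ ⊤ := by
    intro h
    have : Subsingleton (R ⧸ J) := Ideal.Quotient.subsingleton_iff.mpr h
    exact not_subsingleton (R ⧸ J) this
  have hJm : J ≤ maximalIdeal R := IsLocalRing.le_maximalIdeal hJtop
  -- the regular local ring `R̄ = R/(a)` and the image `J̄` of `J`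
  set Ia : Ideal R := Ideal.span (Set.range a) with hIa
  have hIaJ : Ia ≤ J := by
    rw [hIa, Ideal.span_le]
    rintro _ ⟨k, rfl⟩
    exact haJ k
  haveI hRa : IsRegularLocalRing (R ⧸ Ia) := ha.isRegularLocalRing_quotient
  set Jbar : Ideal (R ⧸ Ia) := J.map (Ideal.Quotient.mk Ia) with hJbar
  let e1 : (R ⧸ Ia) ⧸ Jbar ≃+* R ⧸ J := DoubleQuot.quotQuotEquivQuotOfLE hIaJ
  haveI hJbarreg : IsRegularLocalRing ((R ⧸ Ia) ⧸ Jbar) := IsRegularLocalRing.of_ringEquiv e1.symm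
  have hJbartop : Jbar ≠ ⊤ := by
    intro h
    have : Subsingleton ((R ⧸ Ia) ⧸ Jbar) := Ideal.Quotient.subsingleton_iff.mpr h
    exact not_subsingleton ((R ⧸ Ia) ⧸ Jbar) this
  have hJbarm : Jbar ≤ maximalIdeal (R ⧸ Ia) := IsLocalRing.le_maximalIdeal hJbartop
  -- `J̄ = (c̄)` with `c̄` a part of a regular system of parameters of `R̄`
  obtain ⟨r, cbar, hcbar, hcspan⟩ := exists_isRsopPart_span_range_eq (R := R ⧸ Ia) hJbarm
  -- lift to `c ∈ J`
  have hlift : ∀ k, ∃ c ∈ J, Ideal.Quotient.mk Ia c = cbar k := fun k => by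
    have hk : cbar k ∈ Jbar := hcspan ▸ Ideal.subset_span ⟨k, rfl⟩
    exact (Ideal.mem_map_iff_of_surjective _ Ideal.Quotient.mk_surjective).mp hk
  choose c hcJ hc using hlift
  have hcbar_eq : cbar = Ideal.Quotient.mk Ia ∘ c := funext fun k => (hc k).symm
  -- `J = (a, c)`
  have hspan_ac : Ideal.span (Set.range (Fin.append a c)) = J := by
    apply le_antisymm
    · rw [Ideal.span_le, range_fin_append']
      rintro x (⟨k, rfl⟩ | ⟨k, rfl⟩)
      · exact haJ k
      · exact hcJ k
    · intro x hx
      have hxbar : Ideal.Quotient.mk Ia x ∈ (Ideal.span (Set.range c)).map (Ideal.Quotient.mk Ia) := by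
        rw [Ideal.map_span, ← Set.range_comp, ← hcbar_eq, hcspan]
        exact Ideal.mem_map_of_mem _ hx
      rw [← Ideal.mem_comap, Ideal.comap_map_of_surjective _ Ideal.Quotient.mk_surjective,
        ← RingHom.ker_eq_comap_bot, Ideal.mk_ker] at hxbar
      -- `x ∈ (c) ⊔ (a)`
      rw [range_fin_append', Ideal.span_union, sup_comm]
      simpa only [hIa] using hxbar
  -- the final quotient `R/(a, c, b) ≅ (R/J)/(b̄)`
  have hspan_z : Ideal.span (Set.range (Fin.append (Fin.append a c) b)) =
      J ⊔ Ideal.span (Set.range b) := by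
    rw [range_fin_append', Ideal.span_union, hspan_ac]
  have hmapb : (Ideal.span (Set.range b)).map (Ideal.Quotient.mk J) =
      Ideal.span (Set.range (Ideal.Quotient.mk J ∘ b)) := by
    rw [Ideal.map_span, ← Set.range_comp]
  let e2 : (R ⧸ J) ⧸ Ideal.span (Set.range (Ideal.Quotient.mk J ∘ b)) ≃+*
      R ⧸ Ideal.span (Set.range (Fin.append (Fin.append a c) b)) :=
    (Ideal.quotEquivOfEq hmapb.symm).trans
      ((DoubleQuot.quotQuotEquivQuotSup J (Ideal.span (Set.range b))).trans
        (Ideal.quotEquivOfEq hspan_z.symm))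
  haveI hfinal : IsRegularLocalRing (R ⧸ Ideal.span (Set.range (Fin.append (Fin.append a c) b))) :=
    haveI := hb.isRegularLocalRing_quotient
    IsRegularLocalRing.of_ringEquiv e2
  -- dimension count
  have hdim : ringKrullDim (R ⧸ Ideal.span (Set.range (Fin.append (Fin.append a c) b))) +
      ((p + r + q : ℕ) : WithBot ℕ∞) ≤ ringKrullDim R := by
    have h1 := ha.ringKrullDim_quotient_add          -- dim R̄ + p = dim R
    have h2 := hcbar.ringKrullDim_quotient_add       -- dim R̄/(c̄) + r = dim R̄
    have h3 := hb.ringKrullDim_quotient_add          -- dim (R/J)/(b̄) + q = dim R/J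
    rw [hcspan, ringKrullDim_eq_of_ringEquiv e1] at h2
    rw [ringKrullDim_eq_of_ringEquiv e2] at h3
    obtain ⟨dF, hdF⟩ := exists_nat_cast_eq_ringKrullDim
      (R := R ⧸ Ideal.span (Set.range (Fin.append (Fin.append a c) b)))
    obtain ⟨dJ, hdJ⟩ := exists_nat_cast_eq_ringKrullDim (R := R ⧸ J)
    obtain ⟨da, hda⟩ := exists_nat_cast_eq_ringKrullDim (R := R ⧸ Ia)
    obtain ⟨d, hd⟩ := exists_nat_cast_eq_ringKrullDim (R := R)
    rw [hdF, hdJ] at h3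
    rw [hdJ, hda] at h2
    rw [hda, hd] at h1
    rw [hdF, hd]
    have h3' : dF + q = dJ := by exact_mod_cast h3
    have h2' : dJ + r = da := by exact_mod_cast h2
    have h1' : da + p = d := by exact_mod_cast h1
    exact_mod_cast (show dF + (p + r + q) ≤ d by omega)
  have hmem : ∀ i, Fin.append (Fin.append a c) b i ∈ maximalIdeal R := by
    intro i
    refine Fin.addCases (fun j => ?_) (fun j => ?_) i
    · rw [Fin.append_left]
      refine Fin.addCases (fun k => ?_) (fun k => ?_) j
      · rw [Fin.append_left]; exact hJm (haJ k)
      · rw [Fin.append_right]; exact hJm (hcJ k)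
    · rw [Fin.append_right]; exact hbm j
  exact ⟨r, c, hcJ, IsRsopPart.of_isRegularLocalRing_quotient hmem hdim, hspan_ac⟩

end Literature.AlgebraicGeometry.Resolution

end
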